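import Mathlib

/-!
# Preliminaries for `TameDecomposition` — child 1 of the lens-1-g38 split of `RationalPeriodQuarter.SemiAnalyticRigidity`

Lemmas (Mathlib only) for the standalone proof, in `RationalPeriodQuarterTameDecomposition.lean`, of the statement
of the child `TameDecomposition` (decomp-langlands node
`SemiAnalyticRigiditySplit`, stmt-Langlands-2806 split): for `f : ℝ → ℂ` real-analytic off a finite set whose
translation coboundary `f (t+1) - f t` agrees off a finite set with a `PR_ℂ` function, there is a piecewise
rational `ρ` (finitely many real break points, complex fractions) such that `f - ρ` is tame at every real
point (an analytic germ plus ONE fraction on a punctured neighbourhood).  Elementary: one-sided rational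
pieces of the coboundary, transport of "split-tameness" along `x ↦ x - 1` from the analytic tail, and the
explicit `ρ := ∑_{x ∈ F} 1_{(x,∞)} · (jump at x)`.
-/

set_option linter.dupNamespace false

namespace Summit.Langlands.Langlands.Theorems

open Filter Set Topology Polynomial

/-- A cofinitely true predicate on `ℝ` holds on a punctured neighbourhood of every point. -/
theorem tameDecomp_eventually_nhdsNE_of_cofinite {p : ℝ → Prop}
    (h : ∀ᶠ t in Filter.cofinite, p t) (x : ℝ) : ∀ᶠ (t : ℝ) in 𝓝[≠] x, p t := by
  have hfin : Set.Finite {t : ℝ | ¬ p t} := by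
    simpa [Filter.eventually_cofinite] using h
  have hcl : IsClosed ({t : ℝ | ¬ p t} \ {x}) := (hfin.sdiff (t := {x})).isClosed
  have hx : x ∈ ({t : ℝ | ¬ p t} \ {x})ᶜ := by simp
  have hmem : ({t : ℝ | ¬ p t} \ {x})ᶜ ∈ 𝓝 x := hcl.isOpen_compl.mem_nhds hx
  filter_upwards [mem_nhdsWithin_of_mem_nhds hmem, self_mem_nhdsWithin] with t ht hne
  by_contra hpt
  exact ht ⟨hpt, hne⟩

/-- A nonzero complex polynomial vanishes at only finitely many real points. -/
theorem tameDecomp_finite_eval_eq_zero {Q : ℂ[X]} (hQ : Q ≠ 0) :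
    Set.Finite {t : ℝ | Q.eval (t : ℂ) = 0} := by
  have hsub : {t : ℝ | Q.eval (t : ℂ) = 0} ⊆ ((↑) : ℝ → ℂ) ⁻¹' (↑Q.roots.toFinset : Set ℂ) := by
    intro t ht
    simp only [Set.mem_preimage, Finset.mem_coe, Multiset.mem_toFinset]
    exact (Polynomial.mem_roots hQ).2 ht
  exact Set.Finite.subset
    (Set.Finite.preimage Complex.ofReal_injective.injOn (Finset.finite_toSet _)) hsub

/-- A nonzero complex polynomial is nonzero at cofinitely many real points. -/
theorem tameDecomp_eventually_cofinite_eval_ne_zero {Q : ℂ[X]} (hQ : Q ≠ 0) :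
    ∀ᶠ t : ℝ in Filter.cofinite, Q.eval (t : ℂ) ≠ 0 := by
  simpa [Filter.eventually_cofinite] using tameDecomp_finite_eval_eq_zero hQ

/-- A finite sum of polynomial fractions is one polynomial fraction wherever all denominators are nonzero. -/
theorem tameDecomp_sum_fractions {ι : Type*} [DecidableEq ι] (s : Finset ι) (P Q : ι → ℂ[X]) :
    ∃ P' : ℂ[X], ∀ z : ℂ, (∀ i ∈ s, (Q i).eval z ≠ 0) →
      ∑ i ∈ s, (P i).eval z / (Q i).eval z = P'.eval z / (∏ i ∈ s, Q i).eval z := by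
  induction s using Finset.induction_on with
  | empty => exact ⟨0, fun z _ => by simp⟩
  | @insert a s ha ih =>
    obtain ⟨P', hP'⟩ := ih
    refine ⟨P a * ∏ i ∈ s, Q i + Q a * P', fun z hz => ?_⟩
    have hQa : (Q a).eval z ≠ 0 := hz a (Finset.mem_insert_self a s)
    have hs : ∀ i ∈ s, (Q i).eval z ≠ 0 := fun i hi => hz i (Finset.mem_insert_of_mem hi)
    have hprod : (∏ i ∈ s, Q i).eval z ≠ 0 := by
      rw [Polynomial.eval_prod]
      exact Finset.prod_ne_zero_iff.2 hs
    rw [Finset.sum_insert ha, Finset.prod_insert ha, hP' z hs, div_add_div _ _ hQa hprod]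
    simp only [Polynomial.eval_mul, Polynomial.eval_add]

/-- Right rational gap: a rational `b > x` with no element of `F` strictly between `x` and `b`. -/
theorem tameDecomp_exists_rat_gt_gap (F : Finset ℚ) (x : ℝ) :
    ∃ b : ℚ, x < b ∧ ∀ r ∈ F, (r : ℝ) ≤ x ∨ b ≤ r := by
  classical
  by_cases hne : (F.filter (fun r : ℚ => x < r)).Nonempty
  · set S := F.filter (fun r : ℚ => x < r) with hS
    have hmS : S.min' hne ∈ S := S.min'_mem hne
    have hm : x < ((S.min' hne : ℚ) : ℝ) := (Finset.mem_filter.1 hmS).2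
    obtain ⟨b, hb1, hb2⟩ := exists_rat_btwn hm
    refine ⟨b, hb1, fun r hr => ?_⟩
    by_cases hxr : x < r
    · right
      have hle : S.min' hne ≤ r := S.min'_le r (Finset.mem_filter.2 ⟨hr, hxr⟩)
      have : (b : ℝ) < r := lt_of_lt_of_le hb2 (by exact_mod_cast hle)
      exact le_of_lt (by exact_mod_cast this)
    · exact Or.inl (not_lt.1 hxr)
  · obtain ⟨b, hb⟩ := exists_rat_gt x
    refine ⟨b, hb, fun r hr => Or.inl ?_⟩
    by_contra h
    exact hne ⟨r, Finset.mem_filter.2 ⟨hr, not_le.1 h⟩⟩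

/-- Left rational gap: a rational `a < x` with no element of `F` strictly between `a` and `x`. -/
theorem tameDecomp_exists_rat_lt_gap (F : Finset ℚ) (x : ℝ) :
    ∃ a : ℚ, (a : ℝ) < x ∧ ∀ r ∈ F, r ≤ a ∨ x ≤ (r : ℝ) := by
  classical
  by_cases hne : (F.filter (fun r : ℚ => (r : ℝ) < x)).Nonempty
  · set S := F.filter (fun r : ℚ => (r : ℝ) < x) with hS
    have hmS : S.max' hne ∈ S := S.max'_mem hne
    have hm : ((S.max' hne : ℚ) : ℝ) < x := (Finset.mem_filter.1 hmS).2
    obtain ⟨a, ha1, ha2⟩ := exists_rat_btwn hm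
    refine ⟨a, ha2, fun r hr => ?_⟩
    by_cases hxr : (r : ℝ) < x
    · left
      have hle : r ≤ S.max' hne := S.le_max' r (Finset.mem_filter.2 ⟨hr, hxr⟩)
      have : (r : ℝ) < a := lt_of_le_of_lt (by exact_mod_cast hle) ha1
      exact le_of_lt (by exact_mod_cast this)
    · exact Or.inr (not_lt.1 hxr)
  · obtain ⟨a, ha⟩ := exists_rat_lt x
    refine ⟨a, ha, fun r hr => Or.inr ?_⟩
    by_contra h
    exact hne ⟨r, Finset.mem_filter.2 ⟨hr, not_le.1 h⟩⟩

/-- One-sided rational pieces, at EVERY real point, of a `PR_ℂ` function (the break-point clause of the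
route's inlined `IsPRC`). -/
theorem tameDecomp_prc_local (q : ℝ → ℂ) (F : Finset ℚ)
    (hF : ∀ a b : ℚ, a < b → (∀ r ∈ F, r ≤ a ∨ b ≤ r) →
      ∃ (P : Polynomial ℂ) (Q : Polynomial ℚ), ∀ x : ℝ, (a : ℝ) < x → x < b →
        Polynomial.aeval (x : ℂ) Q ≠ 0 ∧ q x = Polynomial.eval (x : ℂ) P / Polynomial.aeval (x : ℂ) Q)
    (x : ℝ) :
    ∃ Pm Qm Pp Qp : ℂ[X],
      (∀ᶠ (t : ℝ) in 𝓝[<] x, Qm.eval (t : ℂ) ≠ 0 ∧ q t = Pm.eval (t : ℂ) / Qm.eval (t : ℂ)) ∧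
      (∀ᶠ (t : ℝ) in 𝓝[>] x, Qp.eval (t : ℂ) ≠ 0 ∧ q t = Pp.eval (t : ℂ) / Qp.eval (t : ℂ)) := by
  obtain ⟨b, hxb, hbF⟩ := tameDecomp_exists_rat_gt_gap F x
  obtain ⟨a, hax, haF⟩ := tameDecomp_exists_rat_lt_gap F x
  -- `aeval` over `ℚ[X]` as `eval` of the mapped polynomial
  have hmap : ∀ (Q : Polynomial ℚ) (t : ℝ),
      Polynomial.aeval (t : ℂ) Q = (Q.map (algebraMap ℚ ℂ)).eval (t : ℂ) := by
    intro Q t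
    rw [Polynomial.aeval_def, Polynomial.eval_map]
  by_cases hx : ∃ a₀ : ℚ, (a₀ : ℝ) = x
  · obtain ⟨a₀, rfl⟩ := hx
    -- right piece on (a₀, b)
    have hab : a₀ < b := by exact_mod_cast hxb
    have hgapR : ∀ r ∈ F, r ≤ a₀ ∨ b ≤ r := by
      intro r hr
      rcases hbF r hr with h | h
      · exact Or.inl (by exact_mod_cast h)
      · exact Or.inr h
    obtain ⟨Pp, QpQ, hR⟩ := hF a₀ b hab hgapR
    -- left piece on (a, a₀)
    have haa : a < a₀ := by exact_mod_cast hax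
    have hgapL : ∀ r ∈ F, r ≤ a ∨ a₀ ≤ r := by
      intro r hr
      rcases haF r hr with h | h
      · exact Or.inl h
      · exact Or.inr (by exact_mod_cast h)
    obtain ⟨Pm, QmQ, hL⟩ := hF a a₀ haa hgapL
    refine ⟨Pm, QmQ.map (algebraMap ℚ ℂ), Pp, QpQ.map (algebraMap ℚ ℂ), ?_, ?_⟩
    · filter_upwards [Ioo_mem_nhdsLT hax] with t ht
      have := hL t ht.1 ht.2
      rw [hmap] at this
      exact this
    · filter_upwards [Ioo_mem_nhdsGT hxb] with t ht
      have := hR t ht.1 ht.2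
      rw [hmap] at this
      exact this
  · -- irrational point: one two-sided piece on (a, b)
    have hab : a < b := by exact_mod_cast (hax.trans hxb)
    have hgap : ∀ r ∈ F, r ≤ a ∨ b ≤ r := by
      intro r hr
      rcases haF r hr with h | h
      · exact Or.inl h
      · rcases hbF r hr with h' | h'
        · exact absurd ⟨r, le_antisymm h' h⟩ hx
        · exact Or.inr h'
    obtain ⟨P, QQ, hP⟩ := hF a b hab hgap
    have hnhds : Set.Ioo (a : ℝ) b ∈ 𝓝 x := Ioo_mem_nhds hax hxb
    refine ⟨P, QQ.map (algebraMap ℚ ℂ), P, QQ.map (algebraMap ℚ ℂ), ?_, ?_⟩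
    · filter_upwards [mem_nhdsWithin_of_mem_nhds hnhds] with t ht
      have := hP t ht.1 ht.2
      rw [hmap] at this
      exact this
    · filter_upwards [mem_nhdsWithin_of_mem_nhds hnhds] with t ht
      have := hP t ht.1 ht.2
      rw [hmap] at this
      exact this

/-- `t ↦ t + 1` maps right (resp. left) punctured neighbourhoods to right (resp. left) ones. -/
theorem tameDecomp_tendsto_add_one_nhdsGT (x : ℝ) :
    Tendsto (fun t : ℝ => t + 1) (𝓝[>] x) (𝓝[>] (x + 1)) := by
  refine tendsto_nhdsWithin_iff.2 ⟨?_, ?_⟩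
  · exact ((continuous_add_const (1 : ℝ)).tendsto x).mono_left nhdsWithin_le_nhds
  · filter_upwards [self_mem_nhdsWithin] with t (ht : x < t)
    simp only [Set.mem_Ioi]
    linarith

/-- `t ↦ t + 1` maps left punctured neighbourhoods to left punctured neighbourhoods. -/
theorem tameDecomp_tendsto_add_one_nhdsLT (x : ℝ) :
    Tendsto (fun t : ℝ => t + 1) (𝓝[<] x) (𝓝[<] (x + 1)) := by
  refine tendsto_nhdsWithin_iff.2 ⟨?_, ?_⟩
  · exact ((continuous_add_const (1 : ℝ)).tendsto x).mono_left nhdsWithin_le_nhds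
  · filter_upwards [self_mem_nhdsWithin] with t (ht : t < x)
    simp only [Set.mem_Iio]
    linarith

/-- TRANSPORT `x + 1 ↦ x` of split-tameness (one two-sided analytic part, one-sided fractions) along
`f t = f (t+1) - q t`. -/
theorem tameDecomp_transport (f q : ℝ → ℂ) (x : ℝ)
    (hx1 : ∃ g : ℝ → ℂ, AnalyticAt ℝ g (x + 1) ∧ ∃ Pm Qm Pp Qp : ℂ[X],
      (∀ᶠ (t : ℝ) in 𝓝[<] (x + 1), Qm.eval (t : ℂ) ≠ 0 ∧ f t = g t + Pm.eval (t : ℂ) / Qm.eval (t : ℂ)) ∧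
      (∀ᶠ (t : ℝ) in 𝓝[>] (x + 1), Qp.eval (t : ℂ) ≠ 0 ∧ f t = g t + Pp.eval (t : ℂ) / Qp.eval (t : ℂ)))
    (hq : ∃ Sm Tm Sp Tp : ℂ[X],
      (∀ᶠ (t : ℝ) in 𝓝[<] x, Tm.eval (t : ℂ) ≠ 0 ∧ q t = Sm.eval (t : ℂ) / Tm.eval (t : ℂ)) ∧
      (∀ᶠ (t : ℝ) in 𝓝[>] x, Tp.eval (t : ℂ) ≠ 0 ∧ q t = Sp.eval (t : ℂ) / Tp.eval (t : ℂ)))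
    (hid : ∀ᶠ (t : ℝ) in 𝓝[≠] x, f (t + 1) - f t = q t) :
    ∃ g : ℝ → ℂ, AnalyticAt ℝ g x ∧ ∃ Pm Qm Pp Qp : ℂ[X],
      (∀ᶠ (t : ℝ) in 𝓝[<] x, Qm.eval (t : ℂ) ≠ 0 ∧ f t = g t + Pm.eval (t : ℂ) / Qm.eval (t : ℂ)) ∧
      (∀ᶠ (t : ℝ) in 𝓝[>] x, Qp.eval (t : ℂ) ≠ 0 ∧ f t = g t + Pp.eval (t : ℂ) / Qp.eval (t : ℂ)) := by
  obtain ⟨g, hg, Pm, Qm, Pp, Qp, hm, hp⟩ := hx1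
  obtain ⟨Sm, Tm, Sp, Tp, hsm, hsp⟩ := hq
  have h1 : AnalyticAt ℝ (fun t : ℝ => t + 1) x := analyticAt_id.add analyticAt_const
  have hg' : AnalyticAt ℝ (fun t : ℝ => g (t + 1)) x := by
    have := AnalyticAt.comp (f := fun t : ℝ => t + 1) (g := g) hg h1
    simpa [Function.comp_def] using this
  have hcomp : ∀ (P : ℂ[X]) (t : ℝ),
      (P.comp (X + C 1)).eval (t : ℂ) = P.eval (((t + 1 : ℝ)) : ℂ) := by
    intro P t
    simp [Polynomial.eval_comp]
  have hidL : ∀ᶠ (t : ℝ) in 𝓝[<] x, f (t + 1) - f t = q t :=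
    hid.filter_mono (nhdsWithin_mono _ (fun t (ht : t < x) => ne_of_lt ht))
  have hidR : ∀ᶠ (t : ℝ) in 𝓝[>] x, f (t + 1) - f t = q t :=
    hid.filter_mono (nhdsWithin_mono _ (fun t (ht : x < t) => ne_of_gt ht))
  refine ⟨fun t => g (t + 1), hg',
    Pm.comp (X + C 1) * Tm - Qm.comp (X + C 1) * Sm, Qm.comp (X + C 1) * Tm,
    Pp.comp (X + C 1) * Tp - Qp.comp (X + C 1) * Sp, Qp.comp (X + C 1) * Tp, ?_, ?_⟩
  · filter_upwards [(tameDecomp_tendsto_add_one_nhdsLT x).eventually hm, hsm, hidL]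
      with t hA hB hC
    have hft : f t = f (t + 1) - q t := by rw [← hC]; ring
    refine ⟨?_, ?_⟩
    · rw [Polynomial.eval_mul, hcomp]
      exact mul_ne_zero hA.1 hB.1
    · rw [hft, hA.2, hB.2, add_sub_assoc, div_sub_div _ _ hA.1 hB.1]
      simp only [Polynomial.eval_mul, Polynomial.eval_sub, hcomp]
  · filter_upwards [(tameDecomp_tendsto_add_one_nhdsGT x).eventually hp, hsp, hidR]
      with t hA hB hC
    have hft : f t = f (t + 1) - q t := by rw [← hC]; ring
    refine ⟨?_, ?_⟩
    · rw [Polynomial.eval_mul, hcomp]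
      exact mul_ne_zero hA.1 hB.1
    · rw [hft, hA.2, hB.2, add_sub_assoc, div_sub_div _ _ hA.1 hB.1]
      simp only [Polynomial.eval_mul, Polynomial.eval_sub, hcomp]

/-- INDUCTION from the analytic tail: every real point is split-tame. -/
theorem tameDecomp_splitTame_all (f q : ℝ → ℂ) (M₀ : ℝ)
    (hM : ∀ x, M₀ ≤ x → AnalyticAt ℝ f x)
    (hq : ∀ x : ℝ, ∃ Sm Tm Sp Tp : ℂ[X],
      (∀ᶠ (t : ℝ) in 𝓝[<] x, Tm.eval (t : ℂ) ≠ 0 ∧ q t = Sm.eval (t : ℂ) / Tm.eval (t : ℂ)) ∧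
      (∀ᶠ (t : ℝ) in 𝓝[>] x, Tp.eval (t : ℂ) ≠ 0 ∧ q t = Sp.eval (t : ℂ) / Tp.eval (t : ℂ)))
    (hid : ∀ x : ℝ, ∀ᶠ (t : ℝ) in 𝓝[≠] x, f (t + 1) - f t = q t) (x : ℝ) :
    ∃ g : ℝ → ℂ, AnalyticAt ℝ g x ∧ ∃ Pm Qm Pp Qp : ℂ[X],
      (∀ᶠ (t : ℝ) in 𝓝[<] x, Qm.eval (t : ℂ) ≠ 0 ∧ f t = g t + Pm.eval (t : ℂ) / Qm.eval (t : ℂ)) ∧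
      (∀ᶠ (t : ℝ) in 𝓝[>] x, Qp.eval (t : ℂ) ≠ 0 ∧ f t = g t + Pp.eval (t : ℂ) / Qp.eval (t : ℂ)) := by
  suffices h : ∀ n : ℕ, ∀ x : ℝ, M₀ - n ≤ x →
      ∃ g : ℝ → ℂ, AnalyticAt ℝ g x ∧ ∃ Pm Qm Pp Qp : ℂ[X],
        (∀ᶠ (t : ℝ) in 𝓝[<] x, Qm.eval (t : ℂ) ≠ 0 ∧ f t = g t + Pm.eval (t : ℂ) / Qm.eval (t : ℂ)) ∧
        (∀ᶠ (t : ℝ) in 𝓝[>] x, Qp.eval (t : ℂ) ≠ 0 ∧ f t = g t + Pp.eval (t : ℂ) / Qp.eval (t : ℂ)) by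
    refine h ⌈M₀ - x⌉₊ x ?_
    have := Nat.le_ceil (M₀ - x)
    linarith
  intro n
  induction n with
  | zero =>
    intro x hx
    refine ⟨f, hM x (by simpa using hx), 0, 1, 0, 1, ?_, ?_⟩
    · exact Filter.Eventually.of_forall fun t => by simp
    · exact Filter.Eventually.of_forall fun t => by simp
  | succ n ih =>
    intro x hx
    have hx1 : M₀ - n ≤ x + 1 := by push_cast at hx; linarith
    exact tameDecomp_transport f q x (ih (x + 1) hx1) (hq x) (hid x)

/-- `𝓝[<] y ⊔ 𝓝[>] y`-eventually gives `𝓝[≠] y`-eventually. -/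
theorem tameDecomp_eventually_nhdsNE {p : ℝ → Prop} {y : ℝ}
    (hl : ∀ᶠ (t : ℝ) in 𝓝[<] y, p t) (hr : ∀ᶠ (t : ℝ) in 𝓝[>] y, p t) :
    ∀ᶠ (t : ℝ) in 𝓝[≠] y, p t := by
  rw [← nhdsLT_sup_nhdsGT]
  exact Filter.eventually_sup.2 ⟨hl, hr⟩

end Summit.Langlands.Langlands.Theorems
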